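import Summits.Parity.GeneralizedHardyLittlewood.Theorems.GreenTaoLevelTwoMNTwoBohrGauge

/-!
# Route `GreenTaoLevelTwo`, crux `MNTwo` (stmt-Parity-21276), line `birth`, stub `stub_mnVertical`:
# from the progression form of Lemmas 23/24 to the single-scale form of Prop. 22 / Prop. 25

Block V4/V5 glue (H4) of the `stub_mnVertical` census (B. Green, T. Tao, *Quadratic uniformity of
the Möbius function*, Ann. Inst. Fourier 58 (2008) = arXiv:math/0606087, end of §10: "Now simply
let `𝒟` be the set of such `d`, set `L := X/ε` …" and the proof of Prop. 25: "Set `X := 1/ρ₁` in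
Proposition 22").  Lemma 23 (`…MNTwoTypeIMajorArc.typeI_major_arc`) and Lemma 24 conclude, for a
divisor `d`, that `‖q•φ''(dt,dt)‖ ≤ M/L²` (some `1 ≤ q ≤ Q`) whenever `L ≥ 1` and `L·ν(dt) ≤ ε`;
Proposition 25 (`…MNTwoDenseDiagonal.dense_diagonal_set`, through
`…MNTwoMajorArcOfDivisors.majorArc_of_divisors`) consumes, at ONE scale `ρ₁ ≤ ε`, the statement
"every multiple `n` of `d` with `ν(n) < ρ₁` has `1 ≤ q ≤ Q` with `‖q•φ''(n,n)‖ ≤ 4Mρ₁²/ε²`".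
This def-free file is that passage (`L := ⌊ε/ρ₁⌋₊`), for an arbitrary gauge `ν`.

* `nat_floor_div_ge_half` — `ε/(2ρ₁) ≤ ⌊ε/ρ₁⌋₊` when `ρ₁ ≤ ε`;
* `good_at_scale_of_progression` — the passage just described.

References: [GreenTao2008QuadraticMobius] arXiv:math/0606087 §10 (end of the type I case), §11
(proof of Prop. 25).
-/

noncomputable section

open Finset Real

namespace Summit.Parity.GeneralizedHardyLittlewood.GreenTaoLevelTwoMNTwoScaleOfProgression

/-- `ε/(2ρ₁) ≤ ⌊ε/ρ₁⌋₊` and `1 ≤ ⌊ε/ρ₁⌋₊` when `0 < ρ₁ ≤ ε`. [folklore] -/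
theorem nat_floor_div_ge_half {ε ρ₁ : ℝ} (hρ₁ : 0 < ρ₁) (hle : ρ₁ ≤ ε) :
    1 ≤ ⌊ε / ρ₁⌋₊ ∧ ε / (2 * ρ₁) ≤ (⌊ε / ρ₁⌋₊ : ℝ) := by
  have h1 : 1 ≤ ε / ρ₁ := by rw [le_div_iff₀ hρ₁]; linarith
  have hfl : 1 ≤ ⌊ε / ρ₁⌋₊ := by
    have := Nat.floor_le_floor h1
    rwa [Nat.floor_one] at this
  refine ⟨hfl, ?_⟩
  have h2 := Nat.lt_floor_add_one (ε / ρ₁)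
  have h3 : (1 : ℝ) ≤ ⌊ε / ρ₁⌋₊ := by exact_mod_cast hfl
  have h4 : ε / (2 * ρ₁) = (ε / ρ₁) / 2 := by rw [div_div, mul_comm]
  rw [h4]
  linarith

/-- **From progressions to one scale (GT 2008b, end of §10 / proof of Prop. 25).**  Let `ν` be a
gauge, `d ∈ ℤ`, and suppose (Lemmas 23/24) that for every `L ≥ 1` and `t` with `L·ν(dt) ≤ ε`
there is `1 ≤ q ≤ Q` with `‖q•φ''(dt,dt)‖ ≤ M/L²` (`M ≥ 0`).  If `0 < ρ₁ ≤ ε` then every multiple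
`n` of `d` with `ν(n) < ρ₁` has `1 ≤ q ≤ Q` with `‖q•φ''(n,n)‖ ≤ 4Mρ₁²/ε²` (take `L = ⌊ε/ρ₁⌋₊`).
[cite: GreenTao2008QuadraticMobius, §10 (type I case, "set `L := X/ε`") and §11 (proof of Prop. 25)] -/
theorem good_at_scale_of_progression (ν : ℤ → ℝ) (hνnn : ∀ x, 0 ≤ ν x)
    (φ : ℤ → UnitAddCircle) (n₀ d : ℤ) {Q ε M ρ₁ : ℝ} (hM : 0 ≤ M) (hρ₁ : 0 < ρ₁) (hle : ρ₁ ≤ ε)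
    (hprog : ∀ (L : ℕ), 1 ≤ L → ∀ (t : ℤ), (L : ℝ) * ν (d * t) ≤ ε →
      ∃ q : ℕ, 1 ≤ q ∧ (q : ℝ) ≤ Q ∧
        ‖q • (φ (n₀ + d * t + d * t) - φ (n₀ + d * t) - φ (n₀ + d * t) + φ n₀)‖ ≤
          M / (L : ℝ) ^ 2)
    (n : ℤ) (hn : ν n < ρ₁) (hdn : d ∣ n) :
    ∃ q : ℕ, 1 ≤ q ∧ (q : ℝ) ≤ Q ∧
      ‖((q : ℤ)) • (φ (n₀ + n + n) - φ (n₀ + n) - φ (n₀ + n) + φ n₀)‖ ≤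
        4 * M * ρ₁ ^ 2 / ε ^ 2 := by
  have hε : 0 < ε := lt_of_lt_of_le hρ₁ hle
  obtain ⟨hL1, hLge⟩ := nat_floor_div_ge_half hρ₁ hle
  set L : ℕ := ⌊ε / ρ₁⌋₊ with hL
  have hLpos : (0 : ℝ) < L := by exact_mod_cast hL1
  have hLle : (L : ℝ) ≤ ε / ρ₁ := Nat.floor_le (by positivity)
  obtain ⟨t, rfl⟩ := hdn
  have hLt : (L : ℝ) * ν (d * t) ≤ ε := by
    calc (L : ℝ) * ν (d * t) ≤ (ε / ρ₁) * ν (d * t) :=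
          mul_le_mul_of_nonneg_right hLle (hνnn _)
      _ ≤ (ε / ρ₁) * ρ₁ := mul_le_mul_of_nonneg_left hn.le (by positivity)
      _ = ε := by field_simp
  obtain ⟨q, hq1, hqQ, hqb⟩ := hprog L hL1 t hLt
  refine ⟨q, hq1, hqQ, ?_⟩
  rw [natCast_zsmul]
  refine hqb.trans ?_
  -- `M/L² ≤ 4Mρ₁²/ε²` since `L ≥ ε/(2ρ₁)`
  have hL2 : (ε / (2 * ρ₁)) ^ 2 ≤ (L : ℝ) ^ 2 := pow_le_pow_left₀ (by positivity) hLge 2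
  have hpos : 0 < (ε / (2 * ρ₁)) ^ 2 := by positivity
  calc M / (L : ℝ) ^ 2 ≤ M / (ε / (2 * ρ₁)) ^ 2 :=
        div_le_div_of_nonneg_left hM hpos hL2
    _ = 4 * M * ρ₁ ^ 2 / ε ^ 2 := by
        field_simp
        ring

end Summit.Parity.GeneralizedHardyLittlewood.GreenTaoLevelTwoMNTwoScaleOfProgression
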